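import Summits.BirchSwinnertonDyer.BirchSwinnertonDyer.Theorems.EdixhovenFibreFiveSevenStarredOptimalManinUnitFiveSevenHcorSquarefree
import Literature.NumberTheory.Automorphic.UnboundedDenominatorsInvariantHomTransferStep
import HarnessLib

set_option autoImplicit false
-- the sub-problem namespace `Summit.BirchSwinnertonDyer.BirchSwinnertonDyer` duplicates a component by design (D-0017)
set_option linter.dupNamespace false

/-!
# K★ line `cdt_thm1`, stub `stub_hcor_invariant`: the square part of the level at primes outside the target

Crux `StarredOptimalManinUnitFiveSeven` (stmt-BirchSwinnertonDyer-22226); skeleton v17 has the single stub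
`stub_hcor_invariant` (all `N`).  With the squarefree level (`HcorSquarefree`) and the transfer step at a prime
already dividing the level (`UnboundedDenominatorsInvariantHomTransferStep`) this file proves:

* `cor453_invariant_form_of_sq_not_dvd_exponent` — if `Q` has exponent `ℓ^a` and **`ℓ² ∤ N`**, every
  `SL₂(ℤ)`-invariant `θ : Γ(N) → Q` is trivial on `Γ(12N)` (induction on `N`: strip one prime `p ≠ ℓ` with
  `p² ∣ N` by the transfer step, down to squarefree `N`);
* `cor453_invariant_form_of_sq_not_dvd` — the same for every finite commutative `Q` such that no prime `ℓ`
  dividing `|Q|` has `ℓ² ∣ N` (prime by prime);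
* `exists_pow_mem_commutator_of_sq_not_dvd` — subgroup form: for `ℓ² ∤ N` there is `k` prime to `ℓ` with
  `x^k ∈ [SL₂(ℤ), Γ(N)]` for all `x ∈ Γ(12N)`: **the finite abelian group `Γ(12N)/(Γ(12N) ∩ [SL₂(ℤ), Γ(N)])`
  has order supported on the primes whose square divides `N`.**

What is left of the stub is exactly its `p`-adic core: targets of `p`-power exponent at levels with `p² ∣ N`
(the Schur multiplier of `SL₂(ℤ/p^e)`, `e ≥ 2`, [Beyl1986]).  K★ / Manin / BSD are not proved.
-/

open scoped MatrixGroups commutatorElement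

namespace Summit.BirchSwinnertonDyer.BirchSwinnertonDyer.Theorems

namespace HcorTransfer

open CongruenceSubgroup Matrix.SpecialLinearGroup ModularGroup
open Literature.NumberTheory.Automorphic.UnboundedDenominators

/-- `Γ(L) ≤ Γ(M)` for `M ∣ L`. [folklore] -/
private theorem Gamma_le_Gamma_of_dvd₆ {M L : ℕ} (h : M ∣ L) : Gamma L ≤ Gamma M := by
  intro γ hγ
  obtain ⟨h00, h01, h10, h11⟩ := Gamma_mem.mp hγ
  have cast_eq : ∀ a : ℤ, ((a : ZMod L).cast : ZMod M) = (a : ZMod M) := fun a ↦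
    ZMod.cast_intCast h a
  rw [Gamma_mem]
  refine ⟨?_, ?_, ?_, ?_⟩
  · rw [← cast_eq, h00, ZMod.cast_one h]
  · rw [← cast_eq, h01, ZMod.cast_zero]
  · rw [← cast_eq, h10, ZMod.cast_zero]
  · rw [← cast_eq, h11, ZMod.cast_one h]

/-- The transfer step with the level as a variable. [cite: CalegariDimitrovTang2025, Corollary 4.5.3] -/
private theorem transfer_step' {Q : Type*} [CommGroup Q] {N M p e M₀ : ℕ} [NeZero M] (hN : N = M * p)
    (hp : p.Prime) (hpM : p ∣ M) (hcop : e.Coprime p) (hQ : ∀ q : Q, q ^ e = 1)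
    (hM : ∀ ψ : Gamma M →* Q,
      (∀ (g x : SL(2, ℤ)) (hx : x ∈ Gamma M) (hgx : g * x * g⁻¹ ∈ Gamma M),
        ψ ⟨g * x * g⁻¹, hgx⟩ = ψ ⟨x, hx⟩) →
      ∀ (x : SL(2, ℤ)) (hx : x ∈ Gamma M), x ∈ Gamma M₀ → ψ ⟨x, hx⟩ = 1)
    (θ : Gamma N →* Q)
    (hθ : ∀ (g x : SL(2, ℤ)) (hx : x ∈ Gamma N) (hgx : g * x * g⁻¹ ∈ Gamma N),
      θ ⟨g * x * g⁻¹, hgx⟩ = θ ⟨x, hx⟩) :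
    ∀ (x : SL(2, ℤ)) (hx : x ∈ Gamma N), x ∈ Gamma M₀ → θ ⟨x, hx⟩ = 1 := by
  subst hN
  exact map_eq_one_of_transfer_step hp hpM hcop hQ hM θ hθ

/-- **Targets of `ℓ`-power exponent, `ℓ² ∤ N`.**  If `Q` is finite commutative of exponent `ℓ^a` (`ℓ` prime)
and `ℓ² ∤ N`, `N ≠ 0`, then every `SL₂(ℤ)`-conjugation-invariant `θ : Γ(N) → Q` is trivial on `Γ(12N)`.
[cite: CalegariDimitrovTang2025, Corollary 4.5.3] [cite: Beyl1986, Theorem] -/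
theorem cor453_invariant_form_of_sq_not_dvd_exponent {ℓ a : ℕ} (hℓ : ℓ.Prime) :
    ∀ {N : ℕ}, N ≠ 0 → ¬ ℓ ^ 2 ∣ N → ∀ (Q : Type*) [CommGroup Q] [Finite Q],
      (∀ q : Q, q ^ (ℓ ^ a) = 1) → ∀ (θ : Gamma N →* Q),
      (∀ (g x : SL(2, ℤ)) (hx : x ∈ Gamma N) (hgx : g * x * g⁻¹ ∈ Gamma N),
        θ ⟨g * x * g⁻¹, hgx⟩ = θ ⟨x, hx⟩) →
      ∀ (x : SL(2, ℤ)) (hx : x ∈ Gamma N), x ∈ Gamma (12 * N) → θ ⟨x, hx⟩ = 1 := by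
  intro N
  induction N using Nat.strong_induction_on with
  | _ N ih =>
  intro hN0 hℓN Q _ _ hQ θ hθ x hx hx12
  by_cases hsq : Squarefree N
  · exact HcorSquarefree.cor453_invariant_form_squarefree hsq Q θ hθ x hx hx12
  · -- a prime `p ≠ ℓ` with `p² ∣ N`; `N = M p` with `p ∣ M`
    rw [Nat.squarefree_iff_prime_squarefree] at hsq
    push Not at hsq
    obtain ⟨p, hp, hpN⟩ := hsq
    have hpℓ : p ≠ ℓ := by
      rintro rfl
      exact hℓN (by rwa [pow_two])
    obtain ⟨c, hc⟩ := hpN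
    have hc0 : c ≠ 0 := by rintro rfl; exact hN0 (by rw [hc, mul_zero])
    haveI : NeZero (p * c) := ⟨Nat.mul_ne_zero hp.ne_zero hc0⟩
    have hNM : N = p * c * p := by rw [hc]; ring
    have hMlt : p * c < N := by
      rw [hNM]
      exact lt_mul_of_one_lt_right (Nat.pos_of_ne_zero (NeZero.ne (p * c))) hp.one_lt
    have hℓM : ¬ ℓ ^ 2 ∣ p * c := fun h ↦ hℓN (h.trans ⟨p, hNM⟩)
    have hcop : (ℓ ^ a).Coprime p := Nat.Coprime.pow_left a ((Nat.coprime_primes hℓ hp).mpr hpℓ.symm)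
    have hM := fun (ψ : Gamma (p * c) →* Q) hψ ↦ ih (p * c) hMlt (NeZero.ne _) hℓM Q hQ ψ hψ
    refine transfer_step' (M₀ := 12 * (p * c)) hNM hp (dvd_mul_right p c) hcop hQ hM θ hθ x hx ?_
    exact Gamma_le_Gamma_of_dvd₆ (mul_dvd_mul_left 12 ⟨p, hNM⟩) hx12

/-- **The `ℓ`-primary part, `ℓ² ∤ N`, for an arbitrary finite target**: `θ(x)^{|Q|/ℓ^{v_ℓ|Q|}} = 1` on
`Γ(12N)` (corestrict a prime-to-`ℓ` power of `θ` to the `ℓ`-power torsion of `Q`).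
[cite: CalegariDimitrovTang2025, Corollary 4.5.3] -/
theorem pow_ordCompl_eq_one_of_sq_not_dvd {ℓ N : ℕ} (hℓ : ℓ.Prime) (hN0 : N ≠ 0) (hℓN : ¬ ℓ ^ 2 ∣ N)
    (Q : Type*) [CommGroup Q] [Finite Q] (θ : Gamma N →* Q)
    (hθ : ∀ (g x : SL(2, ℤ)) (hx : x ∈ Gamma N) (hgx : g * x * g⁻¹ ∈ Gamma N),
      θ ⟨g * x * g⁻¹, hgx⟩ = θ ⟨x, hx⟩) :
    ∀ (x : SL(2, ℤ)) (hx : x ∈ Gamma N), x ∈ Gamma (12 * N) →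
      θ ⟨x, hx⟩ ^ (ordCompl[ℓ] (Nat.card Q)) = 1 := by
  intro x hx hx12
  set n : ℕ := Nat.card Q with hn
  set m : ℕ := ordCompl[ℓ] n with hm_def
  have hnm : ordProj[ℓ] n * m = n := Nat.ordProj_mul_ordCompl_eq_self n ℓ
  have hpow : ∀ (y : Gamma N), ((powMonoidHom m).comp θ) y = θ y ^ m := fun y ↦ rfl
  have he : ∀ y : Gamma N, ((powMonoidHom m).comp θ) y ^ (ℓ ^ n.factorization ℓ) = 1 := by
    intro y
    rw [hpow, ← pow_mul, mul_comm, hnm, hn]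
    exact pow_card_eq_one'
  -- corestriction to the `ℓ^a`-torsion
  set T : Subgroup Q := (powMonoidHom (ℓ ^ n.factorization ℓ) : Q →* Q).ker with hT
  set θT : Gamma N →* T := ((powMonoidHom m).comp θ).codRestrict T
    (fun y ↦ by rw [hT, MonoidHom.mem_ker, powMonoidHom_apply]; exact he y) with hθT
  have hθTval : ∀ y : Gamma N, ((θT y : T) : Q) = θ y ^ m := fun y ↦ rfl
  have hQT : ∀ q : T, q ^ (ℓ ^ n.factorization ℓ) = 1 := by
    intro q
    apply Subtype.ext
    have hq : (q : Q) ∈ (powMonoidHom (ℓ ^ n.factorization ℓ) : Q →* Q).ker := q.2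
    rw [MonoidHom.mem_ker, powMonoidHom_apply] at hq
    rw [Subgroup.coe_pow, Subgroup.coe_one]
    exact hq
  have hθTinv : ∀ (g y : SL(2, ℤ)) (hy : y ∈ Gamma N) (hgy : g * y * g⁻¹ ∈ Gamma N),
      θT ⟨g * y * g⁻¹, hgy⟩ = θT ⟨y, hy⟩ := by
    intro g y hy hgy
    apply Subtype.ext
    rw [hθTval, hθTval, hθ g y hy hgy]
  have h1 := cor453_invariant_form_of_sq_not_dvd_exponent hℓ hN0 hℓN T hQT θT hθTinv x hx hx12
  have h2 := congrArg Subtype.val h1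
  rw [hθTval, Subgroup.coe_one] at h2
  exact h2

/-- **The invariant form of CDT Cor. 4.5.3 whenever no prime dividing `|Q|` has its square dividing `N`**:
every `SL₂(ℤ)`-conjugation-invariant `θ : Γ(N) → Q` is trivial on `Γ(12N)`.  (In particular for all
squarefree `N`, and for all `N` when `gcd(|Q|, N)` is squarefree and prime to `N/gcd`.)
[cite: CalegariDimitrovTang2025, Corollary 4.5.3] [cite: Beyl1986, Theorem] -/
theorem cor453_invariant_form_of_sq_not_dvd {N : ℕ} (hN0 : N ≠ 0) (Q : Type*) [CommGroup Q] [Finite Q]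
    (hQN : ∀ ℓ : ℕ, ℓ.Prime → ℓ ∣ Nat.card Q → ¬ ℓ ^ 2 ∣ N) (θ : Gamma N →* Q)
    (hθ : ∀ (g x : SL(2, ℤ)) (hx : x ∈ Gamma N) (hgx : g * x * g⁻¹ ∈ Gamma N),
      θ ⟨g * x * g⁻¹, hgx⟩ = θ ⟨x, hx⟩) :
    ∀ (x : SL(2, ℤ)) (hx : x ∈ Gamma N), x ∈ Gamma (12 * N) → θ ⟨x, hx⟩ = 1 := by
  intro x hx hx12
  set n : ℕ := Nat.card Q with hn
  have hn0 : n ≠ 0 := Nat.card_pos.ne'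
  by_contra hne
  have hord : orderOf (θ ⟨x, hx⟩) ≠ 1 := fun h1 ↦ hne (orderOf_eq_one_iff.mp h1)
  obtain ⟨ℓ, hℓ, hℓq⟩ := Nat.exists_prime_and_dvd hord
  have hℓn : ℓ ∣ n := hℓq.trans (orderOf_dvd_of_pow_eq_one (hn ▸ pow_card_eq_one'))
  have key := pow_ordCompl_eq_one_of_sq_not_dvd hℓ hN0 (hQN ℓ hℓ hℓn) Q θ hθ x hx hx12
  have h1 : ℓ ∣ ordCompl[ℓ] n := hℓq.trans (orderOf_dvd_of_pow_eq_one key)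
  exact hℓ.one_lt.ne' (Nat.Coprime.eq_one_of_dvd (Nat.coprime_ordCompl hℓ hn0) h1)

/-- In the exact shape of `stub_hcor_invariant`, under the hypothesis that no prime dividing `|Q|` has its square
dividing `N`: `M = 12N`.  K★ / Manin / BSD are NOT proved by this. [cite: CalegariDimitrovTang2025, Corollary 4.5.3] -/
theorem stub_hcor_invariant_of_sq_not_dvd {N : ℕ} (hN0 : N ≠ 0) (Q : Type) [CommGroup Q] [Finite Q]
    (hQN : ∀ ℓ : ℕ, ℓ.Prime → ℓ ∣ Nat.card Q → ¬ ℓ ^ 2 ∣ N) (θ : Gamma N →* Q)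
    (hθ : ∀ (g x : SL(2, ℤ)) (hx : x ∈ Gamma N) (hgx : g * x * g⁻¹ ∈ Gamma N),
      θ ⟨g * x * g⁻¹, hgx⟩ = θ ⟨x, hx⟩) :
    ∃ M : ℕ, M ≠ 0 ∧ ∀ (x : SL(2, ℤ)) (hx : x ∈ Gamma N), x ∈ Gamma M → θ ⟨x, hx⟩ = 1 :=
  ⟨12 * N, Nat.mul_ne_zero (by norm_num) hN0, cor453_invariant_form_of_sq_not_dvd hN0 Q hQN θ hθ⟩

/-- **Subgroup form.**  For `ℓ² ∤ N` (`N ≠ 0`, `ℓ` prime) there is `k` prime to `ℓ` with `x^k ∈ [SL₂(ℤ), Γ(N)]`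
for every `x ∈ Γ(12N)`: the `ℓ`-primary part of `Γ(12N)/(Γ(12N) ∩ [SL₂(ℤ), Γ(N)])` vanishes, so this finite
abelian group is supported on the primes whose square divides `N`. [cite: Beyl1986, Theorem]
[cite: CalegariDimitrovTang2025, Corollary 4.5.3] -/
theorem exists_pow_mem_commutator_of_sq_not_dvd {ℓ N : ℕ} (hℓ : ℓ.Prime) (hN0 : N ≠ 0)
    (hℓN : ¬ ℓ ^ 2 ∣ N) :
    ∃ k : ℕ, ¬ ℓ ∣ k ∧ ∀ x : SL(2, ℤ), x ∈ Gamma (12 * N) → x ^ k ∈ ⁅(⊤ : Subgroup SL(2, ℤ)), Gamma N⁆ := by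
  classical
  haveI : NeZero N := ⟨hN0⟩
  let K' : Subgroup (Gamma N) := (⁅(⊤ : Subgroup SL(2, ℤ)), Gamma N⁆).subgroupOf (Gamma N)
  obtain ⟨B, hinv0, hθ₀⟩ := exists_universal_invariant_hom N
  let θ₀ : Gamma N →* Abelianization (Gamma N) ⧸ B := (QuotientGroup.mk' B).comp Abelianization.of
  have hsurj : Function.Surjective θ₀ :=
    (QuotientGroup.mk'_surjective B).comp QuotientGroup.mk_surjective
  haveI := finiteIndex_commutator_top_Gamma N
  have hK'fin : K'.index ≠ 0 := by
    intro h0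
    have h := Subgroup.relIndex_mul_index
      (show ⁅(⊤ : Subgroup SL(2, ℤ)), Gamma N⁆ ≤ Gamma N from
        Subgroup.commutator_le_right _ _ (h := Gamma_normal N))
    rw [Subgroup.relIndex, show (⁅(⊤ : Subgroup SL(2, ℤ)), Gamma N⁆.subgroupOf (Gamma N)).index = 0
      from h0, zero_mul] at h
    exact Subgroup.FiniteIndex.index_ne_zero h.symm
  have hker : θ₀.ker = K' := by
    ext x
    rw [MonoidHom.mem_ker, hθ₀, Subgroup.mem_subgroupOf]
  haveI : Finite (Abelianization (Gamma N) ⧸ B) := by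
    have hcard : Nat.card (Abelianization (Gamma N) ⧸ B) = K'.index := by
      rw [← hker, Subgroup.index_ker, MonoidHom.range_eq_top.mpr hsurj, Subgroup.card_top]
    exact Nat.finite_of_card_ne_zero (hcard ▸ hK'fin)
  refine ⟨ordCompl[ℓ] (Nat.card (Abelianization (Gamma N) ⧸ B)),
    Nat.not_dvd_ordCompl hℓ Nat.card_pos.ne', fun x hx12 ↦ ?_⟩
  have hx : x ∈ Gamma N := Gamma_le_Gamma_of_dvd₆ (dvd_mul_left N 12) hx12
  have h1 := pow_ordCompl_eq_one_of_sq_not_dvd hℓ hN0 hℓN _ θ₀ hinv0 x hx hx12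
  rw [← map_pow] at h1
  have h2 := (hθ₀ _).mp h1
  rwa [Subgroup.coe_pow] at h2

end HcorTransfer

end Summit.BirchSwinnertonDyer.BirchSwinnertonDyer.Theorems
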